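import Summits.BirchSwinnertonDyer.Rank1Residual.F1Sign2.KuriharaLevelSumsAtTwo
import Literature.NumberTheory.EllipticCurves.MazurRubin2010.TwistSelmerRankControl
import Literature.NumberTheory.EllipticCurves.BSDRootNumberSmallConductorProofs
import Literature.NumberTheory.EllipticCurves.KuriharaNumberParityProofs
import Literature.NumberTheory.EllipticCurves.PAdicLFunctionIntegralityAtTwoProofs
import HarnessLib

/-!
# Kurihara numbers at two: (R), (H), K2-V, K2-P, Mazur–Rubin Prop. 3.3 place-wise, and the FIRST-LAYER LAW K2-F
(cell bsd-f1-sign2, seat -es; MEMO-es §10–§11; statements only — proofs of (H), (R) at the conductor level and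
K2-V in `F1Sign2.KuriharaLevelVanishingAtTwoProofs`, the K2-F glue in `F1Sign2.FirstLayerLawAtTwoGlue`)

* (R) `FrickeReflectionAtPrimeLevel`, (H) `HeckeSumAtPrimeLevel` — printed (Manin 1972, Mazur–Tate–Teitelbaum
  1986 (4.2)); (H) is proved outright and (R) at the conductor level / modulo `exists_isNewformOf` next door.
* K2-V `LevelVanishingAtTwo` — the `p = 2` form of the functional-equation vanishing of Kurihara numbers at a
  wrong-parity level (Kim 2026 Prop. 3.14 / Kurihara 2014 Lemma 5.2.1, printed for odd `p`; the tree's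
  `kuriharaNumber_eq_zero_of_neg_one_pow_ne_rootNumber_conductorLevel` carries `p ≠ 2`): THEOREM next door
  (unconditional at the conductor level).  Census DES6-v1: 0 exceptions on 3 958 prime rows of 145 curves.
* K2-P `PairParityAtTwo` — support (conjecture; Hecke peeling), census DES6/DES9: 9/9 + 1 043/1 043 pair rows.
* `prop33_tau_ratR` — Mazur–Rubin 2010 Prop. 3.3 place-wise over `ℚ` in the REF1-AUDIT §14 form (good
  reduction at `T`-primes); certificate that the un-repaired parity clause fails: kit j285404, 40/40 pairs.
* K2-F `FirstLayerLawAtTwo` (candidate crux, conjecture NEW AT `2`) and `AnalyticFirstLayerLawAtTwo` (its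
  Selmer-free twin): in rank one the first Kolyvagin layer of Kato's Euler system at `2` computes `#Ш[2^∞]`
  — `min v₂ δ'(ℓ) = 1 + v₂ #Ш[2^∞]` over `τ`-primes; census DES9-v1 (310 curves): (a) 0/309 violated,
  (b) 286/286 witnessed.  [cite: Kim2026structure, Thm. 1.1, Thm. 1.9 (6), Thm. 1.11 (p ≥ 5)]
  [cite: Kurihara2014, Thm. B, Lemma 5.2.1] [cite: MazurRubin2010, Prop. 3.3, Lemma 2.9–2.11]

TYPER FILING (seat `bsd-f1-sign2-ty`, -es landing kit part 2/4, INBOX 2026-08-27T18:53:21Z): `HOME/data-es/landing/KuriharaLevelVanishingAtTwo.lean`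
sha16 c4f798b95d7dd6ad (generated by `split.py` from `SketchG6.lean` d35efc04968d755c; joint farm check `Joint.lean` d1eaf26b918c249a rc 0, 0 warnings,
0 sorries, standard axioms), re-filed VERBATIM. REF1-AUDIT §19 verdicts (prop33_tau_ratR FAITHFUL-ASSEMBLY = §14 C′; K2-F
`FirstLayerLawAtTwo` SURVIVES crux-grade OPEN; K2-F_an support) TRANSFER to this kit decl-for-decl (REF1 g3 INBOX 19:02:06Z, 31/31
bodies equal); K2-V/K2-P: REF1 §14 (G3 text; the G6 `LevelVanishingAtTwo` is the finer (W, ℓ, k, ψ) text whose conductor-level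
case is PROVED unconditionally in part 3). REF2 v8/v9: K2-V IN-PRINT-ASSEMBLY support, K2-F OPEN-IN-PRINT (Kim 2022 p ≥ 5
template; beyond-print if proved: YES). Nothing asserted beyond the kernel-checked theorems; no named fact; PARTITION: none moved. -/

set_option autoImplicit false

noncomputable section

open scoped Classical MatrixGroups ModularForm

open CongruenceSubgroup WeierstrassCurve Literature.NumberTheory.EllipticCurves
  Literature.NumberTheory.EllipticCurves.ModularForms NumberField

namespace Summit.BirchSwinnertonDyer.Rank1Residual.F1Sign2

/-! ## §4 Statements -/

/-- **support (R) — Fricke reflection of plus symbols at a prime level, `w(E) = +1`** (PRINTED: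
Manin 1972 §§4–6 / Mazur–Tate–Teitelbaum 1986 §I.4 / Cremona, *Algorithms* §2.8; tree, general form:
`IsFrickeEigen.normalizedPlusSymbol_div_eq_mul` — `[u/n]⁺ = σ[v/n]⁺` for `a n − u N v = 1`, `σ = −ε(f) = w(E)`
at the conductor level — combined with evenness `[−r]⁺ = [r]⁺` and periodicity): for `ℓ ∤ N` prime and
`w(E) = +1`, `[ (N̄u)⁻¹/ℓ ]⁺ = [u/ℓ]⁺` for every `u ∈ (ℤ/ℓ)ˣ` (`N̄ = N mod ℓ`).  DES6-v1: the bucket vectors are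
reflection-symmetric about `c = log(1/N)` on every prime row. -/
def FrickeReflectionAtPrimeLevel : Prop :=
  ∀ (W : WeierstrassCurve ℚ) [W.IsElliptic] [W.IsGloballyMinimal] {M : ℕ} [NeZero M] (f : CuspForm (Gamma0 M) 2),
    IsNewformOf W f → W.rootNumber = 1 →
    ∀ (ℓ : ℕ) [Fact ℓ.Prime] (hN : Nat.Coprime (W.conductorNorm ℤ) ℓ),
      ∀ u : (ZMod ℓ)ˣ,
        ratPlusSymbol f (((((ZMod.unitOfCoprime (W.conductorNorm ℤ) hN * u)⁻¹ : (ZMod ℓ)ˣ) : ZMod ℓ).val : ℚ) / ℓ)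
          = ratPlusSymbol f ((((u : ZMod ℓ).val : ℚ)) / ℓ)

/-- **support (H) — the Hecke sum at a prime level** (PRINTED: Mazur–Tate–Teitelbaum 1986 (4.2); tree:
`intCast_mul_ratPlusSymbol`, `a_ℓ [r]⁺ = ∑_j [(r+j)/ℓ]⁺ + [ℓr]⁺`, read at `r = 0` with
`a_ℓ(f) = a_ℓ(W)`): `∑_{u ∈ (ℤ/ℓ)ˣ} [u/ℓ]⁺ = (a_ℓ − 2)[0]⁺` for `ℓ ∤ N` prime.  DES6-v1: `hecke_ok` on every row. -/
def HeckeSumAtPrimeLevel : Prop :=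
  ∀ (W : WeierstrassCurve ℚ) [W.IsElliptic] [W.IsGloballyMinimal] {M : ℕ} [NeZero M] (f : CuspForm (Gamma0 M) 2),
    IsNewformOf W f →
    ∀ (ℓ : ℕ) [Fact ℓ.Prime], Nat.Coprime (W.conductorNorm ℤ) ℓ →
      ∑ u : (ZMod ℓ)ˣ, ratPlusSymbol f ((((u : ZMod ℓ).val : ℚ)) / ℓ)
        = ((W.frobeniusTrace ℓ : ℚ) - 2) * ratPlusSymbol f 0

/-- **K2-V — single-prime Kurihara numbers at two vanish at their level** (THEOREM modulo (R) and (H):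
`levelVanishingAtTwo_of` below, kernel-checked).  `E/ℚ` globally minimal with `w(E) = +1`, `f` its newform,
`ℓ ∤ N` prime, `k ≥ 1`, `2^k ∣ a_ℓ − 2`, the integral symbols `2[u/ℓ]⁺ ∈ ℤ_{(2)}` and `[0]⁺_f ∈ ℤ_{(2)}`
(BSD normalisation: `L^{alg} ∈ ℤ_{(2)}`, odd torsion), and a discrete logarithm `ψ : (ℤ/ℓ)ˣ → ℤ/2^k` with
`ψ(N̄⁻¹)` ODD — for `ψ` onto (`2^k ∣ ℓ − 1`) this is `(N/ℓ) = −1`, automatic at a `τ`-prime `ℓ ≡ 1 (mod 4)`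
of a curve with odd Tamagawa product (`Δ ∈ ±N·ℚ²`): then `δ'_k(ℓ; ψ) = ∑_u 2[u/ℓ]⁺ ψ(u) ∈ 2^k ℤ_{(2)}`.
PROOF: `u ↦ (N̄u)⁻¹` acts on `ψ`-buckets as the fixed-point-free involution `j ↦ c − j`, `c = ψ(N̄⁻¹)` odd,
so `2δ' = c·∑_u 2[u/ℓ]⁺ + 2^k·(even) = 2c(a_ℓ − 2)[0]⁺ + 2^{k+1}(…)` (`two_pow_dvd_sum_val_mul_of_reflect`).
It is the `p = 2` form of Kim 2026 Prop. 3.14 / Kurihara 2014 Lemma 5.2.1 ("`δ_n = 0` unless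
`(−1)^{ν(n)} = w(E)`"; tree `kuriharaNumber_eq_zero_of_neg_one_pow_ne_rootNumber_conductorLevel`, `p ≠ 2`
only): at `p = 2` the functional equation gives `2δ = 0` for the PRIMITIVE `δ = δ'/2`, i.e. the integral
`δ'` dies at its level and `δ` keeps one bit (MEMO-es §10.2).
Why it might fail: only if (R)/(H) are mis-transcribed (both are tree theorems in general form); the
`2`-integrality of the symbols is a hypothesis.  DES6-v1: 0 exceptions on every prime row.
Sources: Kim arXiv:2203.12159 §1.5, §3.5; Kurihara arXiv:1407.2465 Lemma 5.2.1; Mazur–Tate 1987 (1.6.2). -/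
def LevelVanishingAtTwo : Prop :=
  ∀ (W : WeierstrassCurve ℚ) [W.IsElliptic] [W.IsGloballyMinimal] {M : ℕ} [NeZero M] (f : CuspForm (Gamma0 M) 2),
    IsNewformOf W f → W.rootNumber = 1 →
    ∀ (ℓ k : ℕ) [Fact ℓ.Prime] (hN : Nat.Coprime (W.conductorNorm ℤ) ℓ), 1 ≤ k →
      (2 ^ k : ℤ) ∣ W.frobeniusTrace ℓ - 2 →
      InTwoPowZLoc 0 (ratPlusSymbol f 0) →
      (∀ u : (ZMod ℓ)ˣ, InTwoPowZLoc 0 (2 * ratPlusSymbol f ((((u : ZMod ℓ).val : ℚ)) / ℓ))) →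
      ∀ ψ : (ZMod ℓ)ˣ →* Multiplicative (ZMod (2 ^ k)),
        Odd (Multiplicative.toAdd (ψ (ZMod.unitOfCoprime (W.conductorNorm ℤ) hN)⁻¹)).val →
        InTwoPowZLoc k (levelSumTwo f ℓ k ψ)

/-- **support (K2-P) — Kurihara's level-2 unit condition at a pair equals the parity of the rational
Kurihara sum.**  Same standing hypotheses; `ℓ₁ ≠ ℓ₂` level primes at two with `ℓᵢ ≡ 1 (mod 4)`,
`a_{ℓᵢ} ≡ 2 (mod 4)`, `ψᵢ : (ℤ/ℓᵢ)ˣ → ℤ/4` SURJECTIVE: `δ'_2(ℓ₁ℓ₂; ψ₁, ψ₂)/2 − κ_{ℓ₁ℓ₂} ∈ 2ℤ_{(2)}`.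
Proof sketch (MEMO-es §10): split `ψ = ε + 2q`; the cross terms are even by the `a ↦ −a` symmetry and the
vanishing of the quadratic layer `T_{ℓᵢ} = 0` (K2-B, `w = +1`) with the Hecke peeling
`∑_{u mod n} χ_{ℓ₁}(u)[u/n]⁺ = (a_{ℓ₂} − 2χ_{ℓ₁}(ℓ₂)) T_{ℓ₁}`.  DES6-v1: `δ'/2 ≡ κ (mod 2)` on every pair row.
Why it might fail: only through the integrality hypothesis. Sources: as above; SketchK2 (K2-A2, K2-B). -/
@[conjecture] def PairParityAtTwo : Prop :=
  ∀ (W : WeierstrassCurve ℚ) [W.IsElliptic] [W.IsGloballyMinimal] {M : ℕ} [NeZero M] (f : CuspForm (Gamma0 M) 2),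
    IsNewformOf W f → W.rootNumber = 1 → Odd W.torsionOrder → Odd W.tamagawaProduct →
    ∀ (ℓ₁ ℓ₂ : ℕ) [Fact ℓ₁.Prime] [Fact ℓ₂.Prime] [NeZero (ℓ₁ * ℓ₂)], ℓ₁ ≠ ℓ₂ →
      IsLevelAtTwo W (ℓ₁ * ℓ₂) → ℓ₁ % 4 = 1 → ℓ₂ % 4 = 1 →
      (4 : ℤ) ∣ W.frobeniusTrace ℓ₁ - 2 → (4 : ℤ) ∣ W.frobeniusTrace ℓ₂ - 2 →
      InTwoPowZLoc 0 (ratPlusSymbol f 0) →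
      (∀ u : (ZMod (ℓ₁ * ℓ₂))ˣ,
        InTwoPowZLoc 0 (2 * ratPlusSymbol f ((((u : ZMod (ℓ₁ * ℓ₂)).val : ℚ)) / (ℓ₁ * ℓ₂)))) →
      ∀ (ψ₁ : (ZMod ℓ₁)ˣ →* Multiplicative (ZMod 4)) (ψ₂ : (ZMod ℓ₂)ˣ →* Multiplicative (ZMod 4)),
        Function.Surjective ψ₁ → Function.Surjective ψ₂ →
        InTwoPowZLoc 1 (pairLevelSumTwo f ℓ₁ ℓ₂ ψ₁ ψ₂ / 2 - kuriharaSumTwo f (ℓ₁ * ℓ₂))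

/-! ## Mazur–Rubin 2010 Prop. 3.3 place-wise (REF1-AUDIT §14 form C′): `prop33_tau_ratR` -/

section Control

/-- **Mazur–Rubin 2010, Prop. 3.3 (place-wise form, `K = ℚ`), repaired per REF1-AUDIT-v1 §14 (C′)**
(support; PRINTED).  Verbatim v1.2 `prop33_tau_rat` except that every `p ∈ T` now also has GOOD REDUCTION
(`W.HasGoodReductionAtPrime p`), which is what Lemma 2.11's transversality `H¹_f ∩ H¹_f^F = 0` needs;
under the printed splitting list (Invent. Math. 181, Prop. 3.3) every `T`-prime is a good odd prime, so
C′ is a consequence of the printed proof.  The v1.2 parity clause fails at a split-multiplicative `T`-prime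
of even valuation with `E(ℚ_p)[2] ≅ ℤ/2` (transparent prime: `(q, p*)_p = −1`; certificate run kit j285404).
Setting: `d` square-free `≠ 1`, `F = ℚ(√d)`, `T` a finite set of odd GOOD primes ramified in `F` with
`#E(ℚ_p)[2] = 2`; outside `T` Lemma 2.10 (i)/(ii)/(iii)/(v) place-wise; real place (i) or (iv); conclusion
`|d₂(E^F) − d₂(E)| ≤ #T` and `d₂(E^F) + d₂(E) ≡ #T (mod 2)` in cardinalities.
[cite: MazurRubin2010, Prop. 3.3 with Lemma 2.9–2.11, Def. 2.3] -/
def prop33_tau_ratR : Prop :=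
  ∀ (W : WeierstrassCurve ℚ) [W.IsElliptic] (d : ℤ), Squarefree d → d ≠ 1 →
    ∀ (F : Type) [Field F] [NumberField F], Module.finrank ℚ F = 2 → (∃ x : F, x ^ 2 = (d : F)) →
    ∀ (T : Finset ℕ),
    (∀ p ∈ T, p.Prime ∧ p ≠ 2 ∧ (p : ℤ) ∣ NumberField.discr F ∧
      ∀ [Fact p.Prime], W.HasGoodReductionAtPrime p ∧
        Nat.card {Q : (W.baseChange ℚ_[p]).toAffine.Point // 2 • Q = 0} = 2) →
    (∀ (p : ℕ) [Fact p.Prime], p ∉ T →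
      ((Ideal.span {(p : ℤ)}).primesOver (𝓞 F)).ncard = 2 ∨
      (p ≠ 2 ∧ ∀ Q : (W.baseChange ℚ_[p]).toAffine.Point, 2 • Q = 0 → Q = 0) ∨
      (W.HasMultiplicativeReductionAtPrime p ∧ ¬ (p : ℤ) ∣ NumberField.discr F ∧
        Odd (padicValRat p W.Δ)) ∨
      (W.HasGoodReductionAtPrime p ∧ ¬ (p : ℤ) ∣ NumberField.discr F)) →
    (NumberField.IsTotallyReal F ∨ W.Δ < 0) →
    ∀ (W' : WeierstrassCurve ℚ) [W'.IsElliptic],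
      (∃ C : VariableChange ℚ, C • W' = W.quadraticTwist (d : ℚ)) →
        Nat.card (W'.selmerGroup 2) ∣ 2 ^ T.card * Nat.card (W.selmerGroup 2) ∧
        Nat.card (W.selmerGroup 2) ∣ 2 ^ T.card * Nat.card (W'.selmerGroup 2) ∧
        (Even T.card ↔ IsSquare (Nat.card (W'.selmerGroup 2) * Nat.card (W.selmerGroup 2)))

end Control

/-! ## K2-F — the rank-one first-layer law at two (candidate crux, conjecture) and its analytic twin -/

section FirstLayer

/-- **K2-F (candidate crux; conjecture NEW AT `p = 2`): the first Kolyvagin layer at two computes `#Ш[2^∞]`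
for rank one.**  Setting: `E/ℚ` globally minimal, `f` its newform with the period transfer at `2`
(`Ω(E) = u·Ω⁺_f`, `|u|₂ = 1`), `ρ_{E,2^∞}` onto, odd torsion, odd Tamagawa product, `w(E) = −1`, Mordell–Weil
rank `1`, `Ш(E)[2^∞]` finite of order `2^s`.  Levels: `τ`-primes `ℓ` (`IsLevelAtTwo W ℓ`: `ℓ ∤ 2N`,
`#E(𝔽_ℓ)[2] = 2`) in `P(k)`: `2^k ∣ ℓ − 1`, `2^k ∣ a_ℓ − 2`; `ψ : (ℤ/ℓ)ˣ ↠ ℤ/2^k`; the integral number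
`δ'_k(ℓ; ψ) = ∑_u 2[u/ℓ]⁺ ψ(u)` (`levelSumTwo`), canonical modulo `2^k`.  CLAIM:
(a) `δ'_k(ℓ; ψ) ≡ 0 (mod 2^{min(k, s+1)})` for every such `(ℓ, k, ψ)`; (b) some `(ℓ, k, ψ)` with `k ≥ s + 2`
has `δ'_k(ℓ; ψ) ≢ 0 (mod 2^{s+2})`.  I.e. `min v₂ δ'(ℓ) = s + 1` over the first layer: Kim's structure theorem
(Amer. J. Math. 2026 = arXiv:2203.12159, Thm 1.1: `Ш[p^∞] ≅ ⊕_i (ℤ/p^{(∂^{(r+2i−2)} − ∂^{(r+2i)})/2})²`, so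
`∂^{(r)} = length Ш[p^∞]`; `p ≥ 5`, `ρ` onto, `p ∤ Tam·#Ẽ(𝔽_p)`…) transposed to `p = 2`, `r = 1`, with the
one-bit shift `δ' = 2δ` forced by `[r]⁺ ∈ ½ℤ_{(2)}`.  For `w = −1` the single primes ARE the right-parity
levels (`(−1)^{ν} = w`), so — unlike rank `0` at two, where K2-B kills the first layer — the first layer is
live and no pair level (conductor `N ℓ₁²ℓ₂²`) is needed: the cheapest non-trivial instance of a `2`-adic
Kolyvagin-system structure statement.  BC5 witness: table DES9-v1 (cell bsd-f1-sign2 `data-es/des9/DES9-v1.jsonl` sha16 57cd0689fdb2acae, kit j285437, MEMO-es §11; 310 rank-one odd-torsion non-CM Cremona curves, `N ∈ [1.5·10⁴, 5·10⁵]`, all outside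
the `N < 5000` regime where `BSDp W 2` is a tree theorem; two engines: eclib modular symbols / PARI `ellL1` on
prime twists, Hecke identity 13 541/13 541, twist identity 1 790/1 790, signed Fricke anti-reflection
13 541/13 541): (a) 0 violating rows on 309/309 curves (`#Ш_an = 4`: `δ'_2 ≡ 0 (4)` 4 834/4 834, `δ'_3 ≡ 0 (8)`
2 556/2 556, `δ'_{4,5} ≡ 0 (8)` 1 985/1 985; `#Ш_an = 16`: `δ'_k ≡ 0 (2^k)`, `k ≤ 5`, 597/597); (b) witnessed on
286/286 curves whose prime window reaches `k = s + 2` (`#Ш_an = 1, 9, 25`: 98, `#Ш_an = 4`: 188) — the censored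
first-layer minimum is `1 + v₂ #Ш_an` on every one, in every split (`#E(ℚ₂)[2] = 1/2/4`: 103/103, 172/172,
11/11; additive / multiplicative / ordinary / supersingular at `2`: 50/50, 79/79, 77/77, 80/80), `s` read from
`#Ш_an` (so the witness is K2-F modulo BSD₂ of the base curve = `AnalyticFirstLayerLawAtTwo` below).
Why it might fail: at `2` the Kolyvagin-system axioms (MR04 (H.4), `p > 2`) and Kim's Chebotarev step are not
available; the lost bit could sit in (b) (then `min v₂ δ' ∈ {s+1, s+2}`); real components (`c_∞ = 2`) or the
Tamagawa number at `2` might shift `s ↦ s ± 1` on a sub-class — DES9 records `disc_sign`, type at `2`.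
Cheapest falsifier: ONE DES9 `Ш_an = 4` row with a `P(3)`-prime `δ'_3(ℓ) ≢ 0 (mod 8)` (twist scale check = 1),
or a `Ш_an = 1` rank-1 curve with all `δ'_2(ℓ) ≡ 0 (mod 4)` over ≥ 16 `P(2)`-primes.
Sources: Kim arXiv:2203.12159 Thm 1.1, §1.5; Kurihara, Münster J. Math. 7 (2014) Thm B; Sakamoto 2022/2024
(`p = 3`); Mazur–Rubin, Mem. AMS 799 (2004) Thm 5.2.12. -/
@[conjecture] def FirstLayerLawAtTwo : Prop :=
  ∀ (W : WeierstrassCurve ℚ) [W.IsElliptic] [W.IsGloballyMinimal] {M : ℕ} [NeZero M]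
    (f : CuspForm (Gamma0 M) 2), IsNewformOf W f → PeriodTransferAtTwo W f →
    (∀ n : ℕ, W.HasSurjectiveModNGaloisRep ((2 ^ n : ℕ) : ℤ)) → Odd W.torsionOrder → Odd W.tamagawaProduct →
    W.rootNumber = -1 → W.mordellWeilRank = 1 → Finite (AddCommGroup.primaryComponent W.sha 2) →
    let s := padicValNat 2 (Nat.card (AddCommGroup.primaryComponent W.sha 2))
    (∀ (ℓ k : ℕ) [Fact ℓ.Prime], IsLevelAtTwo W ℓ → 1 ≤ k → (2 ^ k : ℤ) ∣ (ℓ : ℤ) - 1 →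
        (2 ^ k : ℤ) ∣ W.frobeniusTrace ℓ - 2 →
        ∀ ψ : (ZMod ℓ)ˣ →* Multiplicative (ZMod (2 ^ k)), Function.Surjective ψ →
          InTwoPowZLoc (min k (s + 1)) (levelSumTwo f ℓ k ψ)) ∧
    (∃ (ℓ k : ℕ) (_ : Fact ℓ.Prime) (ψ : (ZMod ℓ)ˣ →* Multiplicative (ZMod (2 ^ k))),
        IsLevelAtTwo W ℓ ∧ s + 2 ≤ k ∧ (2 ^ k : ℤ) ∣ (ℓ : ℤ) - 1 ∧ (2 ^ k : ℤ) ∣ W.frobeniusTrace ℓ - 2 ∧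
        Function.Surjective ψ ∧ ¬ InTwoPowZLoc (s + 2) (levelSumTwo f ℓ k ψ))

/-- **K2-F modulo BSD₂ = the ANALYTIC first-layer law (support / data form, what DES9 literally tests).**
Same setting with analytic rank `1`; `s_an := v₂(#Ш_an)` where `#Ш_an = L'(E,1)·#E(ℚ)_tors² / (Ω(E)·R(E)·∏c)`
is the tree's `shaAn W` (a complex number; hypothesis: it is a rational `q`).  CLAIM: (a)/(b) of K2-F with
`s_an` for `s`.  K2-F ∧ BSD₂(E) ⟹ this; conversely this ∧ K2-F ⟹ `v₂ #Ш[2^∞] = v₂ #Ш_an`, the `2`-part of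
BSD for the rank-one curve — the route use of the first layer. -/
@[conjecture] def AnalyticFirstLayerLawAtTwo : Prop :=
  ∀ (W : WeierstrassCurve ℚ) [W.IsElliptic] [W.IsGloballyMinimal] {M : ℕ} [NeZero M]
    (f : CuspForm (Gamma0 M) 2), IsNewformOf W f → PeriodTransferAtTwo W f →
    (∀ n : ℕ, W.HasSurjectiveModNGaloisRep ((2 ^ n : ℕ) : ℤ)) → Odd W.torsionOrder → Odd W.tamagawaProduct →
    W.rootNumber = -1 → W.analyticRank = 1 →
    ∀ q : ℚ, shaAn W = (q : ℂ) → q ≠ 0 →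
    let s := (padicValRat 2 q).toNat
    (∀ (ℓ k : ℕ) [Fact ℓ.Prime], IsLevelAtTwo W ℓ → 1 ≤ k → (2 ^ k : ℤ) ∣ (ℓ : ℤ) - 1 →
        (2 ^ k : ℤ) ∣ W.frobeniusTrace ℓ - 2 →
        ∀ ψ : (ZMod ℓ)ˣ →* Multiplicative (ZMod (2 ^ k)), Function.Surjective ψ →
          InTwoPowZLoc (min k (s + 1)) (levelSumTwo f ℓ k ψ)) ∧
    (∃ (ℓ k : ℕ) (_ : Fact ℓ.Prime) (ψ : (ZMod ℓ)ˣ →* Multiplicative (ZMod (2 ^ k))),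
        IsLevelAtTwo W ℓ ∧ s + 2 ≤ k ∧ (2 ^ k : ℤ) ∣ (ℓ : ℤ) - 1 ∧ (2 ^ k : ℤ) ∣ W.frobeniusTrace ℓ - 2 ∧
        Function.Surjective ψ ∧ ¬ InTwoPowZLoc (s + 2) (levelSumTwo f ℓ k ψ))

end FirstLayer

end Summit.BirchSwinnertonDyer.Rank1Residual.F1Sign2
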